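import Summits.HodgeConjecture.CorCM.IrreducibleOddWeightsIsotypicSplittingDefect
import Summits.HodgeConjecture.CorCM.IrreducibleOddWeightsShadowModulesCMFields
import HarnessLib

/-!
# Isotypic cells, VII (CM fields): `dim Hg(A₀)+dim Hg(A₁)−dim Hg(A₀×A₁)` is a SUM over isotypic classes of the odd
# weights, each pure class of dimension-`d` constituents contributing a MULTIPLE of `d`

COR-CM (cell `pub-hodgecm2`, binder seat `b16` gen 70, count-neutral claim ISOTYPIC SPLITTING OF THE DEFECT, file I7 — CM
fields; theorems only, no definition, no named fact, no `sorry`).  NEW as stated, hence under `Summits/`.  HONEST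
FRAMING: Galois theory of CM fields inside `ℂ` and linear algebra of odd weights (files I1–I6), with consequences for
`dim MT(A₀ × A₁)` of abelian varieties with complex multiplication (Kubota–Dodson rank = `dim MT`, Pohlmann); nothing is
claimed about the algebraicity of Hodge classes; `HC_CM` is neither used nor asserted.

SETTING.  CM fields `K_{i₀} ⊇ T₀`, `K_{i₁} ⊇ T₁`, the CM subfields `T_κ` containing the traces (TR); the SHADOW `w_κ` of
`Φ_κ` on `Hom(T_κ, ℂ)` lies in the odd weights `Anti(T_κ) ≤ ℚ^{Hom(T_κ,ℂ)}` (gen 68/69).  `Anti(T_κ)` is a semisimple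
`Aut(ℂ)`-module (finite Galois image); group its stable irreducible constituents into CLASSES closed under equivariant
isomorphism.  Gen 69 treated ONE irreducible constituent per side (Q3/Q4: defect `0` or `dim`) and «irreducible ⊕ line»
(Q11); here: ANY number of constituents, ANY multiplicities.

* **`exists_cmTypeRank_add_cmTypeRank_eq_add_mul_of_class`** (ONE-SIDED): if the shadow of `Φ₀` on a (TR) pivot `T₀`
  lies in a sum of stable irreducible submodules of `ℚ^{Hom(T₀,ℂ)}` ALL OF DIMENSION `d`, then for EVERY partner
  **`cmTypeRank Φ₀ + cmTypeRank Φ₁ = cmFamilyRank Φ + 1 + m·d`** — the defect `dim Hg(A₀)+dim Hg(A₁)−dim Hg(A₀×A₁)` is a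
  multiple of `d`; in particular when `Anti(T₀)` itself is such a sum (`…_of_antiWeights_le`: every CM type of `K_{i₀}`,
  every partner).
* **`cmTypeRank_add_cmTypeRank_eq_add_add_of_cut`**: along an isotypic cut (classes `A`, `B` of constituents of
  `Anti(T₀)`, `Anti(T₁)`, no `A`-constituent embedding into a `B`-constituent; `w_κ = p_κ + q_κ`) the defect is
  **`dim(S(p₀) ∩ S(p₁)) + dim(S(q₀) ∩ S(q₁))`**; both classes pure of dimensions `d`, `d′`: **`= m·d + m′·d′`**
  (`exists_cmTypeRank_add_cmTypeRank_eq_add_mul_add_mul_of_cut`).  Iterating the cut splits the defect over all classes.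

DICTIONARY (census of this lane, gens 67–69).  Base #24 (`C₂ × S₃`): `Anti = χ ⊕ V` on both sides, `χ₀ ≇ χ₁`, classes
`{V₀, V₁}` and `{χ₀, χ₁}` ⟹ defect `= m·2 + 0`, `m·2 ≤ dim S(v₀) = 2`: `{0, 2}` (= gen 69 Q11b); dyadic (8,8) twins:
one irreducible of dimension `4` per side: `{0, 4}`; a pair of fields whose odd weights are `V ⊕ V′` with `V ≇ V′` both
of dimension `2` against the same: `m·2 + m′·2 ∈ {0, 2, 4}`.

## References

* [Gordon1999HodgeAVSurvey] B. B. Gordon, *A survey of the Hodge conjecture for abelian varieties*, §3 Theorem (Imai,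
  Murty) with proof, 7.5–7.7, 9.4.3.
* [Serre1977] J.-P. Serre, *Linear Representations of Finite Groups*, GTM 42, §2.6.
* [Shimura1998] G. Shimura, *Abelian Varieties with Complex Multiplication and Modular Functions*, §18.1.
* [Deligne1982HodgeCycles] P. Deligne, *Hodge cycles on abelian varieties*, LNM 900, I §3 Ex. 3.7.
-/

set_option autoImplicit false

noncomputable section

open scoped BigOperators Classical

open CategoryTheory CategoryTheory.Limits NumberField Module IntermediateField

namespace Summit.HodgeConjecture.CorCM

open Literature.NumberTheory.ComplexMultiplication
open Literature.AlgebraicGeometry.Motives (AbelianVariety CMType)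
open Literature.AlgebraicGeometry.Motives.AbelianVariety
open Literature.AlgebraicGeometry.HodgeTheory
open Literature.AlgebraicGeometry.ComplexMultiplication (IsCMTypeRealisation)
open Literature.AlgebraicGeometry.Pohlmann1968

variable {I : Type} [Fintype I] {K : I → Type} [∀ i, Field (K i)] [∀ i, NumberField (K i)] [∀ i, IsCMField (K i)]
  {T₀ : Type} [Field T₀] [NumberField T₀] {T₁ : Type} [Field T₁] [NumberField T₁]

/-! ### §1 One-sided class quantisation -/

/-- **ONE-SIDED CLASS QUANTISATION (CM fields).**  `T₀ ⊆ K_{i₀}` a subfield containing the traces of the partner (TR);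
the shadow `w₀` of `Φ₀` on `Hom(T₀, ℂ)` lies in a sum `Σ_j A_j` of `Aut(ℂ)`-stable IRREDUCIBLE submodules of
`ℚ^{Hom(T₀,ℂ)}` all of dimension `d`.  Then for EVERY partner type `Φ₁` of `K_{i₁}`:
`cmTypeRank Φ₀ + cmTypeRank Φ₁ = cmFamilyRank Φ + 1 + m·d` — **`d ∣ dim Hg(A₀)+dim Hg(A₁)−dim Hg(A₀×A₁)`**.
[cite: Gordon1999HodgeAVSurvey, §3 Theorem, 7.5–7.7 and 9.4.3] [cite: Serre1977, §2.6] -/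
theorem exists_cmTypeRank_add_cmTypeRank_eq_add_mul_of_class {i₀ i₁ : I} (h01 : i₀ ≠ i₁) (hI : ∀ l, l = i₀ ∨ l = i₁)
    (Φ : ∀ i, CMType (K i)) [Algebra T₀ (K i₀)]
    (htr₀ : ∀ (a : K i₀ →+* ℂ) (k : K i₀), a k ∈ normalClosure ℚ (K i₁) ℂ → k ∈ Set.range (algebraMap T₀ (K i₀)))
    {J₀ : Type} [Fintype J₀] {A₀ : J₀ → Submodule ℚ ((T₀ →+* ℂ) → ℚ)}
    (hA₀st : ∀ (j : J₀) (k : ℂ ≃+* ℂ) (a : (T₀ →+* ℂ) → ℚ), a ∈ A₀ j → (fun y => a (k • y)) ∈ A₀ j)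
    (hA₀irr : ∀ (j : J₀) (W : Submodule ℚ ((T₀ →+* ℂ) → ℚ)), W ≤ A₀ j → W ≠ ⊥ →
      (∀ (k : ℂ ≃+* ℂ) (f : (T₀ →+* ℂ) → ℚ), f ∈ W → (fun y => f (k • y)) ∈ W) → W = A₀ j)
    {d : ℕ} (hd₀ : ∀ j, Module.finrank ℚ (A₀ j) = d)
    (hw₀ : (fun y : T₀ →+* ℂ => ∑ t ∈ Finset.univ.filter (fun t : K i₀ →+* ℂ => t.comp (algebraMap T₀ (K i₀)) = y),
        antiVec (Φ i₀).1 (1 : ℂ ≃+* ℂ) t) ∈ ⨆ j, A₀ j) :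
    ∃ m : ℕ, cmTypeRank (Φ i₀) + cmTypeRank (Φ i₁) = CMAlgebra.cmFamilyRank Φ + 1 + m * d := by
  haveI : ∀ i, Nonempty (K i →+* ℂ) := fun i => inferInstance
  exact IrrOdd.exists_typeRank_add_typeRank_eq_add_mul_of_class (G := ℂ ≃+* ℂ) (E := fun i => K i →+* ℂ)
    (Φ := fun i => (Φ i).1) (fun i => isCMTypeWith_conj (Φ i)) hI h01
    (fun t : K i₀ →+* ℂ => t.comp (algebraMap T₀ (K i₀))) (fun _ _ => rfl)
    (exists_stab_smul_eq_of_comp_eq_of_trace_le i₁ htr₀) hA₀st hA₀irr hd₀ hw₀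

/-- **THE SAME WHEN `Anti(T₀)` ITSELF IS A SUM OF IRREDUCIBLES OF DIMENSION `d`** (`T₀` a CM subfield with (TR)): for
EVERY CM type of `K_{i₀}` and EVERY partner the defect `dim Hg(A₀)+dim Hg(A₁)−dim Hg(A₀×A₁)` is a multiple of `d`.
[cite: Gordon1999HodgeAVSurvey, §3 Theorem, 7.5–7.7 and 9.4.3] [cite: Serre1977, §2.6] [cite: Shimura1998, §18.1] -/
theorem exists_cmTypeRank_add_cmTypeRank_eq_add_mul_of_antiWeights_le {i₀ i₁ : I} (h01 : i₀ ≠ i₁)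
    (hI : ∀ l, l = i₀ ∨ l = i₁) (Φ : ∀ i, CMType (K i)) [Algebra T₀ (K i₀)]
    (htr₀ : ∀ (a : K i₀ →+* ℂ) (k : K i₀), a k ∈ normalClosure ℚ (K i₁) ℂ → k ∈ Set.range (algebraMap T₀ (K i₀)))
    {J₀ : Type} [Fintype J₀] {A₀ : J₀ → Submodule ℚ ((T₀ →+* ℂ) → ℚ)}
    (hA₀st : ∀ (j : J₀) (k : ℂ ≃+* ℂ) (a : (T₀ →+* ℂ) → ℚ), a ∈ A₀ j → (fun y => a (k • y)) ∈ A₀ j)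
    (hA₀irr : ∀ (j : J₀) (W : Submodule ℚ ((T₀ →+* ℂ) → ℚ)), W ≤ A₀ j → W ≠ ⊥ →
      (∀ (k : ℂ ≃+* ℂ) (f : (T₀ →+* ℂ) → ℚ), f ∈ W → (fun y => f (k • y)) ∈ W) → W = A₀ j)
    {d : ℕ} (hd₀ : ∀ j, Module.finrank ℚ (A₀ j) = d)
    (hsum : antiWeights (E := T₀ →+* ℂ) (starRingAut : ℂ ≃+* ℂ) ≤ ⨆ j, A₀ j) :
    ∃ m : ℕ, cmTypeRank (Φ i₀) + cmTypeRank (Φ i₁) = CMAlgebra.cmFamilyRank Φ + 1 + m * d :=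
  exists_cmTypeRank_add_cmTypeRank_eq_add_mul_of_class h01 hI Φ htr₀ hA₀st hA₀irr hd₀
    (hsum (shadow_comp_algebraMap_mem_antiWeights (Φ i₀)))

/-! ### §2 The defect splits over an isotypic cut -/

/-- **THE DEFECT SPLITS OVER AN ISOTYPIC CUT (CM fields).**  `T₀ ⊆ K_{i₀}`, `T₁ ⊆ K_{i₁}` subfields containing the
traces (TR); classes `A` (`A⁰_j ≤ ℚ^{Hom(T₀,ℂ)}`, `A¹_j ≤ ℚ^{Hom(T₁,ℂ)}`) and `B` (`B⁰_k`, `B¹_k`) of `Aut(ℂ)`-stable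
irreducible constituents, no non-zero `A`-constituent embedding equivariantly into a `B`-constituent; the shadows
decompose as `w_κ = p_κ + q_κ` with `p_κ ∈ Σ A^κ`, `q_κ ∈ Σ B^κ`.  Then
**`cmTypeRank Φ₀ + cmTypeRank Φ₁ = cmFamilyRank Φ + 1 + dim(S(p₀) ∩ S(p₁)) + dim(S(q₀) ∩ S(q₁))`**: the defect
`dim Hg(A₀)+dim Hg(A₁)−dim Hg(A₀×A₁)` is the SUM of the class defects. [cite: Gordon1999HodgeAVSurvey, §3 Theorem, 7.5–7.7
and 9.4.3] [cite: Serre1977, §2.6] [cite: Deligne1982HodgeCycles, I §3 Ex. 3.7] -/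
theorem cmTypeRank_add_cmTypeRank_eq_add_add_of_cut {i₀ i₁ : I} (h01 : i₀ ≠ i₁) (hI : ∀ l, l = i₀ ∨ l = i₁)
    (Φ : ∀ i, CMType (K i)) [Algebra T₀ (K i₀)] [Algebra T₁ (K i₁)]
    (htr₀ : ∀ (a : K i₀ →+* ℂ) (k : K i₀), a k ∈ normalClosure ℚ (K i₁) ℂ → k ∈ Set.range (algebraMap T₀ (K i₀)))
    (htr₁ : ∀ (b : K i₁ →+* ℂ) (k : K i₁), b k ∈ normalClosure ℚ (K i₀) ℂ → k ∈ Set.range (algebraMap T₁ (K i₁)))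
    {J₀ J₁ K₀ K₁ : Type} [Fintype J₀] [Fintype J₁] [Fintype K₀] [Fintype K₁]
    {A₀ : J₀ → Submodule ℚ ((T₀ →+* ℂ) → ℚ)} {A₁ : J₁ → Submodule ℚ ((T₁ →+* ℂ) → ℚ)}
    {B₀ : K₀ → Submodule ℚ ((T₀ →+* ℂ) → ℚ)} {B₁ : K₁ → Submodule ℚ ((T₁ →+* ℂ) → ℚ)}
    (hA₀st : ∀ (j : J₀) (k : ℂ ≃+* ℂ) (a : (T₀ →+* ℂ) → ℚ), a ∈ A₀ j → (fun y => a (k • y)) ∈ A₀ j)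
    (hA₀irr : ∀ (j : J₀) (W : Submodule ℚ ((T₀ →+* ℂ) → ℚ)), W ≤ A₀ j → W ≠ ⊥ →
      (∀ (k : ℂ ≃+* ℂ) (f : (T₀ →+* ℂ) → ℚ), f ∈ W → (fun y => f (k • y)) ∈ W) → W = A₀ j)
    (hA₁st : ∀ (j : J₁) (k : ℂ ≃+* ℂ) (a : (T₁ →+* ℂ) → ℚ), a ∈ A₁ j → (fun y => a (k • y)) ∈ A₁ j)
    (hA₁irr : ∀ (j : J₁) (W : Submodule ℚ ((T₁ →+* ℂ) → ℚ)), W ≤ A₁ j → W ≠ ⊥ →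
      (∀ (k : ℂ ≃+* ℂ) (f : (T₁ →+* ℂ) → ℚ), f ∈ W → (fun y => f (k • y)) ∈ W) → W = A₁ j)
    (hB₀st : ∀ (j : K₀) (k : ℂ ≃+* ℂ) (a : (T₀ →+* ℂ) → ℚ), a ∈ B₀ j → (fun y => a (k • y)) ∈ B₀ j)
    (hB₀irr : ∀ (j : K₀) (W : Submodule ℚ ((T₀ →+* ℂ) → ℚ)), W ≤ B₀ j → W ≠ ⊥ →
      (∀ (k : ℂ ≃+* ℂ) (f : (T₀ →+* ℂ) → ℚ), f ∈ W → (fun y => f (k • y)) ∈ W) → W = B₀ j)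
    (hB₁st : ∀ (j : K₁) (k : ℂ ≃+* ℂ) (a : (T₁ →+* ℂ) → ℚ), a ∈ B₁ j → (fun y => a (k • y)) ∈ B₁ j)
    (hB₁irr : ∀ (j : K₁) (W : Submodule ℚ ((T₁ →+* ℂ) → ℚ)), W ≤ B₁ j → W ≠ ⊥ →
      (∀ (k : ℂ ≃+* ℂ) (f : (T₁ →+* ℂ) → ℚ), f ∈ W → (fun y => f (k • y)) ∈ W) → W = B₁ j)
    (h₀₀ : ∀ (j : J₀) (k : K₀) (L : ((T₀ →+* ℂ) → ℚ) →ₗ[ℚ] ((T₀ →+* ℂ) → ℚ)), A₀ j ≠ ⊥ →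
      (∀ a ∈ A₀ j, L a ∈ B₀ k) → (∀ a ∈ A₀ j, L a = 0 → a = 0) →
      (∀ (g : ℂ ≃+* ℂ) (a : (T₀ →+* ℂ) → ℚ), a ∈ A₀ j → L (fun y => a (g • y)) = fun y => L a (g • y)) → False)
    (h₀₁ : ∀ (j : J₀) (k : K₁) (L : ((T₀ →+* ℂ) → ℚ) →ₗ[ℚ] ((T₁ →+* ℂ) → ℚ)), A₀ j ≠ ⊥ →
      (∀ a ∈ A₀ j, L a ∈ B₁ k) → (∀ a ∈ A₀ j, L a = 0 → a = 0) →
      (∀ (g : ℂ ≃+* ℂ) (a : (T₀ →+* ℂ) → ℚ), a ∈ A₀ j → L (fun y => a (g • y)) = fun y => L a (g • y)) → False)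
    (h₁₀ : ∀ (j : J₁) (k : K₀) (L : ((T₁ →+* ℂ) → ℚ) →ₗ[ℚ] ((T₀ →+* ℂ) → ℚ)), A₁ j ≠ ⊥ →
      (∀ a ∈ A₁ j, L a ∈ B₀ k) → (∀ a ∈ A₁ j, L a = 0 → a = 0) →
      (∀ (g : ℂ ≃+* ℂ) (a : (T₁ →+* ℂ) → ℚ), a ∈ A₁ j → L (fun y => a (g • y)) = fun y => L a (g • y)) → False)
    (h₁₁ : ∀ (j : J₁) (k : K₁) (L : ((T₁ →+* ℂ) → ℚ) →ₗ[ℚ] ((T₁ →+* ℂ) → ℚ)), A₁ j ≠ ⊥ →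
      (∀ a ∈ A₁ j, L a ∈ B₁ k) → (∀ a ∈ A₁ j, L a = 0 → a = 0) →
      (∀ (g : ℂ ≃+* ℂ) (a : (T₁ →+* ℂ) → ℚ), a ∈ A₁ j → L (fun y => a (g • y)) = fun y => L a (g • y)) → False)
    {p₀ q₀ : (T₀ →+* ℂ) → ℚ} {p₁ q₁ : (T₁ →+* ℂ) → ℚ} (hp₀ : p₀ ∈ ⨆ j, A₀ j) (hq₀ : q₀ ∈ ⨆ k, B₀ k)
    (hp₁ : p₁ ∈ ⨆ j, A₁ j) (hq₁ : q₁ ∈ ⨆ k, B₁ k)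
    (hw₀ : (fun y : T₀ →+* ℂ => ∑ t ∈ Finset.univ.filter (fun t : K i₀ →+* ℂ => t.comp (algebraMap T₀ (K i₀)) = y),
        antiVec (Φ i₀).1 (1 : ℂ ≃+* ℂ) t) = p₀ + q₀)
    (hw₁ : (fun y : T₁ →+* ℂ => ∑ t ∈ Finset.univ.filter (fun t : K i₁ →+* ℂ => t.comp (algebraMap T₁ (K i₁)) = y),
        antiVec (Φ i₁).1 (1 : ℂ ≃+* ℂ) t) = p₁ + q₁) :
    cmTypeRank (Φ i₀) + cmTypeRank (Φ i₁) = CMAlgebra.cmFamilyRank Φ + 1 +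
      Module.finrank ℚ ↥(Submodule.span ℚ (Set.range fun y : T₀ →+* ℂ => fun g : ℂ ≃+* ℂ => p₀ (g • y)) ⊓
          Submodule.span ℚ (Set.range fun y : T₁ →+* ℂ => fun g : ℂ ≃+* ℂ => p₁ (g • y))) +
        Module.finrank ℚ ↥(Submodule.span ℚ (Set.range fun y : T₀ →+* ℂ => fun g : ℂ ≃+* ℂ => q₀ (g • y)) ⊓
          Submodule.span ℚ (Set.range fun y : T₁ →+* ℂ => fun g : ℂ ≃+* ℂ => q₁ (g • y))) := by
  haveI : ∀ i, Nonempty (K i →+* ℂ) := fun i => inferInstance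
  exact IrrOdd.typeRank_add_typeRank_eq_add_add_of_cut (G := ℂ ≃+* ℂ) (E := fun i => K i →+* ℂ)
    (Φ := fun i => (Φ i).1) (fun i => isCMTypeWith_conj (Φ i)) hI h01
    (fun t : K i₀ →+* ℂ => t.comp (algebraMap T₀ (K i₀))) (fun t : K i₁ →+* ℂ => t.comp (algebraMap T₁ (K i₁)))
    (fun _ _ => rfl) (fun _ _ => rfl) (exists_stab_smul_eq_of_comp_eq_of_trace_le i₁ htr₀)
    (exists_stab_smul_eq_of_comp_eq_of_trace_le i₀ htr₁) hA₀st hA₀irr hA₁st hA₁irr hB₀st hB₀irr hB₁st hB₁irr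
    h₀₀ h₀₁ h₁₀ h₁₁ hp₀ hq₀ hp₁ hq₁ hw₀ hw₁

/-- **BOTH CLASSES PURE (CM fields)**: if moreover every `A`-constituent has dimension `d` and every `B`-constituent
dimension `d′`, then `cmTypeRank Φ₀ + cmTypeRank Φ₁ = cmFamilyRank Φ + 1 + m·d + m′·d′`.
[cite: Gordon1999HodgeAVSurvey, §3 Theorem, 7.5–7.7 and 9.4.3] [cite: Serre1977, §2.6] -/
theorem exists_cmTypeRank_add_cmTypeRank_eq_add_mul_add_mul_of_cut {i₀ i₁ : I} (h01 : i₀ ≠ i₁)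
    (hI : ∀ l, l = i₀ ∨ l = i₁) (Φ : ∀ i, CMType (K i)) [Algebra T₀ (K i₀)] [Algebra T₁ (K i₁)]
    (htr₀ : ∀ (a : K i₀ →+* ℂ) (k : K i₀), a k ∈ normalClosure ℚ (K i₁) ℂ → k ∈ Set.range (algebraMap T₀ (K i₀)))
    (htr₁ : ∀ (b : K i₁ →+* ℂ) (k : K i₁), b k ∈ normalClosure ℚ (K i₀) ℂ → k ∈ Set.range (algebraMap T₁ (K i₁)))
    {J₀ J₁ K₀ K₁ : Type} [Fintype J₀] [Fintype J₁] [Fintype K₀] [Fintype K₁]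
    {A₀ : J₀ → Submodule ℚ ((T₀ →+* ℂ) → ℚ)} {A₁ : J₁ → Submodule ℚ ((T₁ →+* ℂ) → ℚ)}
    {B₀ : K₀ → Submodule ℚ ((T₀ →+* ℂ) → ℚ)} {B₁ : K₁ → Submodule ℚ ((T₁ →+* ℂ) → ℚ)}
    (hA₀st : ∀ (j : J₀) (k : ℂ ≃+* ℂ) (a : (T₀ →+* ℂ) → ℚ), a ∈ A₀ j → (fun y => a (k • y)) ∈ A₀ j)
    (hA₀irr : ∀ (j : J₀) (W : Submodule ℚ ((T₀ →+* ℂ) → ℚ)), W ≤ A₀ j → W ≠ ⊥ →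
      (∀ (k : ℂ ≃+* ℂ) (f : (T₀ →+* ℂ) → ℚ), f ∈ W → (fun y => f (k • y)) ∈ W) → W = A₀ j)
    (hA₁st : ∀ (j : J₁) (k : ℂ ≃+* ℂ) (a : (T₁ →+* ℂ) → ℚ), a ∈ A₁ j → (fun y => a (k • y)) ∈ A₁ j)
    (hA₁irr : ∀ (j : J₁) (W : Submodule ℚ ((T₁ →+* ℂ) → ℚ)), W ≤ A₁ j → W ≠ ⊥ →
      (∀ (k : ℂ ≃+* ℂ) (f : (T₁ →+* ℂ) → ℚ), f ∈ W → (fun y => f (k • y)) ∈ W) → W = A₁ j)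
    (hB₀st : ∀ (j : K₀) (k : ℂ ≃+* ℂ) (a : (T₀ →+* ℂ) → ℚ), a ∈ B₀ j → (fun y => a (k • y)) ∈ B₀ j)
    (hB₀irr : ∀ (j : K₀) (W : Submodule ℚ ((T₀ →+* ℂ) → ℚ)), W ≤ B₀ j → W ≠ ⊥ →
      (∀ (k : ℂ ≃+* ℂ) (f : (T₀ →+* ℂ) → ℚ), f ∈ W → (fun y => f (k • y)) ∈ W) → W = B₀ j)
    (hB₁st : ∀ (j : K₁) (k : ℂ ≃+* ℂ) (a : (T₁ →+* ℂ) → ℚ), a ∈ B₁ j → (fun y => a (k • y)) ∈ B₁ j)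
    (hB₁irr : ∀ (j : K₁) (W : Submodule ℚ ((T₁ →+* ℂ) → ℚ)), W ≤ B₁ j → W ≠ ⊥ →
      (∀ (k : ℂ ≃+* ℂ) (f : (T₁ →+* ℂ) → ℚ), f ∈ W → (fun y => f (k • y)) ∈ W) → W = B₁ j)
    (h₀₀ : ∀ (j : J₀) (k : K₀) (L : ((T₀ →+* ℂ) → ℚ) →ₗ[ℚ] ((T₀ →+* ℂ) → ℚ)), A₀ j ≠ ⊥ →
      (∀ a ∈ A₀ j, L a ∈ B₀ k) → (∀ a ∈ A₀ j, L a = 0 → a = 0) →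
      (∀ (g : ℂ ≃+* ℂ) (a : (T₀ →+* ℂ) → ℚ), a ∈ A₀ j → L (fun y => a (g • y)) = fun y => L a (g • y)) → False)
    (h₀₁ : ∀ (j : J₀) (k : K₁) (L : ((T₀ →+* ℂ) → ℚ) →ₗ[ℚ] ((T₁ →+* ℂ) → ℚ)), A₀ j ≠ ⊥ →
      (∀ a ∈ A₀ j, L a ∈ B₁ k) → (∀ a ∈ A₀ j, L a = 0 → a = 0) →
      (∀ (g : ℂ ≃+* ℂ) (a : (T₀ →+* ℂ) → ℚ), a ∈ A₀ j → L (fun y => a (g • y)) = fun y => L a (g • y)) → False)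
    (h₁₀ : ∀ (j : J₁) (k : K₀) (L : ((T₁ →+* ℂ) → ℚ) →ₗ[ℚ] ((T₀ →+* ℂ) → ℚ)), A₁ j ≠ ⊥ →
      (∀ a ∈ A₁ j, L a ∈ B₀ k) → (∀ a ∈ A₁ j, L a = 0 → a = 0) →
      (∀ (g : ℂ ≃+* ℂ) (a : (T₁ →+* ℂ) → ℚ), a ∈ A₁ j → L (fun y => a (g • y)) = fun y => L a (g • y)) → False)
    (h₁₁ : ∀ (j : J₁) (k : K₁) (L : ((T₁ →+* ℂ) → ℚ) →ₗ[ℚ] ((T₁ →+* ℂ) → ℚ)), A₁ j ≠ ⊥ →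
      (∀ a ∈ A₁ j, L a ∈ B₁ k) → (∀ a ∈ A₁ j, L a = 0 → a = 0) →
      (∀ (g : ℂ ≃+* ℂ) (a : (T₁ →+* ℂ) → ℚ), a ∈ A₁ j → L (fun y => a (g • y)) = fun y => L a (g • y)) → False)
    {d d' : ℕ} (hd₀ : ∀ j, Module.finrank ℚ (A₀ j) = d) (hd' : ∀ k, Module.finrank ℚ (B₀ k) = d')
    {p₀ q₀ : (T₀ →+* ℂ) → ℚ} {p₁ q₁ : (T₁ →+* ℂ) → ℚ} (hp₀ : p₀ ∈ ⨆ j, A₀ j) (hq₀ : q₀ ∈ ⨆ k, B₀ k)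
    (hp₁ : p₁ ∈ ⨆ j, A₁ j) (hq₁ : q₁ ∈ ⨆ k, B₁ k)
    (hw₀ : (fun y : T₀ →+* ℂ => ∑ t ∈ Finset.univ.filter (fun t : K i₀ →+* ℂ => t.comp (algebraMap T₀ (K i₀)) = y),
        antiVec (Φ i₀).1 (1 : ℂ ≃+* ℂ) t) = p₀ + q₀)
    (hw₁ : (fun y : T₁ →+* ℂ => ∑ t ∈ Finset.univ.filter (fun t : K i₁ →+* ℂ => t.comp (algebraMap T₁ (K i₁)) = y),
        antiVec (Φ i₁).1 (1 : ℂ ≃+* ℂ) t) = p₁ + q₁) :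
    ∃ m m' : ℕ, cmTypeRank (Φ i₀) + cmTypeRank (Φ i₁) = CMAlgebra.cmFamilyRank Φ + 1 + m * d + m' * d' := by
  haveI : ∀ i, Nonempty (K i →+* ℂ) := fun i => inferInstance
  exact IrrOdd.exists_typeRank_add_typeRank_eq_add_mul_add_mul_of_cut (G := ℂ ≃+* ℂ) (E := fun i => K i →+* ℂ)
    (Φ := fun i => (Φ i).1) (fun i => isCMTypeWith_conj (Φ i)) hI h01
    (fun t : K i₀ →+* ℂ => t.comp (algebraMap T₀ (K i₀))) (fun t : K i₁ →+* ℂ => t.comp (algebraMap T₁ (K i₁)))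
    (fun _ _ => rfl) (fun _ _ => rfl) (exists_stab_smul_eq_of_comp_eq_of_trace_le i₁ htr₀)
    (exists_stab_smul_eq_of_comp_eq_of_trace_le i₀ htr₁) hA₀st hA₀irr hA₁st hA₁irr hB₀st hB₀irr hB₁st hB₁irr
    h₀₀ h₀₁ h₁₀ h₁₁ hd₀ hd' hp₀ hq₀ hp₁ hq₁ hw₀ hw₁

end Summit.HodgeConjecture.CorCM

end
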